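import Summits.CriticalPhenomena.PercolationContinuityZ3.Theorems.PercNearOneGluingNoHeavyLowerTailFourPointRowsLeFive

/-!
# `NoHeavyLowerTail` (crux stmt-CriticalPhenomena-4575): the seven FOUR-POINT classes of E3GRP rows (Richards–Sahi `E₃ ≥ 0` on
# group-separation events of four terminals) hold on every weighted graph with at most five vertices — kernel-checked, and
# three-copy FIBREWISE (Richards-comb) positive there

Support file (certificate seat `prim-cert-2`; `--supports stmt-CriticalPhenomena-4575`; COMPUTATIONAL: the fourteen `checkE3`
evaluations use `native_decide`).

Context (prim-sahi CENSUS.md §3–§4, ttrl2 line 423 `sahi-c3-4point-classes`).  Pulling the 77 five-terminal E3GRP rows of the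
SHK3⁺/bern4 Bernstein step back to the four-point law of `(a, b, c, y)` leaves exactly SEVEN classes of Richards–Sahi triples of
GROUP-SEPARATION events `D[X|Y] = {no open path between X and Y}` (decreasing) / `U[X|Y] = D[X|Y]ᶜ` (increasing):

* `(iii)`  `E₃(D[a|b], D[a|c], D[b|cy])`      — pairwise non-nested; the pull-back of `r3`; contains `F` as the face "`y` isolated";
* `(ii)`   `E₃(D[a|b], D[a|bcy], D[b|cy])`    — nested (a Harris-level theorem on every graph, `sahiE3_nonneg_of_subset`);
* `(b)`    `E₃(D[a|bc], D[a|y], D[bc|y])`     — `SEP3({a},{y},{b,c})`;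
* `F`      `E₃(D[a|b], D[a|c], D[b|c])`       — = SHK3⁺ = 3PT-LB, a theorem on every finite graph (`ThreePointLB.sahiE3_pairSep_nonneg`);
* `α`      `E₃(U[a|bc], U[ab|c], U[acy|b])`;
* `β`      `E₃(U[a|bcy], U[ab|cy], U[acy|b])`;
* `γ`      `E₃(U[ab|cy], U[ac|by], U[ay|bc])`  — `S₄`-invariant.

`…E3GroupSepLeFive` (`e3grp_five`) certifies the nine FIVE-terminal representatives on `K₅`; a four-point class inherits a kernel
certificate on five-vertex graphs (four terminals + ONE STEINER vertex) only when it is an `rᵢ` not mentioning the fifth terminal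
(`(b) = r1`, `γ = r4`), so before this file the classes `(iii)`, `α`, `β` were kernel-certified on four-vertex graphs only.

**Theorem `fourPointClass_le_five`.**  For every `i : Fin 7`, every `n ≤ 5`, every `w : Sym2 (Fin n) → [0,1]` and all pairwise
distinct `a b c y : Fin n`, class `i` holds at `(a, b, c, y)` (`E3Ineq`: `μ(A)μ(BC) + μ(B)μ(AC) + μ(C)μ(AB) ≤ 2μ(ABC) + μ(A)μ(B)μ(C)`,
`μ = prodBernoulli w`).  Proof: the three-copy checker `checkE3` of `…E3GroupSepCertCheck` passes for each class at the standard
quadruple `(0,1,2,3)` of `K₄` (base `2^22`) and of `K₅` (base `2^34`, vertex `4` Steiner) by `native_decide` — i.e. ALL `4^6` resp. `4^10`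
tensor-Bernstein fibre sums of `E₃` are nonnegative integers (Richards-comb positivity, the signature of a copy-switching proof) —
and the other distinct quadruples follow by transport along vertex relabellings (`rowHolds4_relabel`).  A second, independent
implementation (prim-sahi-census `fibre3.py`) found the same `K₅` fibre tables sign-free; ttrl2's `e3fibre_big.c` finds all seven
classes fibre-positive on `K₆` too (`4^15` coefficients each, 0 negative) — beyond the plain in-kernel Kronecker check, NOT claimed here.
Spelled out: `classIII_le_five`, `classAlpha_le_five`, `classBeta_le_five` (the three classes that were open at `n = 5`).
-/

namespace Summit.CriticalPhenomena.PercolationContinuityZ3.Theorems.E3GroupSepCert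

open Finset MeasureTheory OneCutCert CovTransferCert
open scoped BigOperators
open Literature.Probability.Percolation Literature.Probability.LatticeModels

variable {n : ℕ}

/-! ## The seven four-point classes (prim-sahi CENSUS.md §4; terminal order `a, b, c, y`) -/

/-- The triple of events of four-point class `i` at `t = (a, b, c, y)`:
0 `(iii) = E₃(D[a|b], D[a|c], D[b|cy])`, 1 `(ii) = E₃(D[a|b], D[a|bcy], D[b|cy])`, 2 `(b) = E₃(D[a|bc], D[a|y], D[bc|y])`,
3 `F = E₃(D[a|b], D[a|c], D[b|c])`, 4 `α = E₃(U[a|bc], U[ab|c], U[acy|b])`, 5 `β = E₃(U[a|bcy], U[ab|cy], U[acy|b])`,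
6 `γ = E₃(U[ab|cy], U[ac|by], U[ay|bc])`. [this work] -/
def row4 (i : Fin 7) (t : Quad n) : (CRel n → Bool) × (CRel n → Bool) × (CRel n → Bool) :=
  let a := t.1
  let b := t.2.1
  let c := t.2.2.1
  let y := t.2.2.2
  match i with
  | 0 => (sep [a] [b], sep [a] [c], sep [b] [c, y])
  | 1 => (sep [a] [b], sep [a] [b, c, y], sep [b] [c, y])
  | 2 => (sep [a] [b, c], sep [a] [y], sep [b, c] [y])
  | 3 => (sep [a] [b], sep [a] [c], sep [b] [c])
  | 4 => (lnk [a] [b, c], lnk [a, b] [c], lnk [a, c, y] [b])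
  | 5 => (lnk [a] [b, c, y], lnk [a, b] [c, y], lnk [a, c, y] [b])
  | 6 => (lnk [a, b] [c, y], lnk [a, c] [b, y], lnk [a, y] [b, c])

/-- Four-point class `i` holds at `(w, t)`: `E₃ ≥ 0` for its three events. [this work] -/
def Row4Holds (i : Fin 7) (w : Sym2 (Fin n) → unitInterval) (t : Quad n) : Prop :=
  E3Ineq w (row4 i t).1 (row4 i t).2.1 (row4 i t).2.2

/-! ## Transport along vertex relabellings -/

/-- The four-point rows under relabelling. [this work] -/
theorem row4_relP (i : Fin 7) (τ : Fin n ≃ Fin n) (t : Quad n) :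
    (relP τ (row4 i t).1, relP τ (row4 i t).2.1, relP τ (row4 i t).2.2) = row4 i (quadmap τ t) := by
  obtain ⟨a, b, c, y⟩ := t
  fin_cases i <;> simp [row4, quadmap, relP_sep, relP_lnk]

/-- **A four-point row is transported along a relabelling of the vertices.** [this work] -/
theorem rowHolds4_relabel (i : Fin 7) (σ : Fin n ≃ Fin n) (w : Sym2 (Fin n) → unitInterval) (t : Quad n)
    (h : Row4Holds i w t) : Row4Holds i (relabelW σ w) (quadmap σ t) := by
  have hr := row4_relP i σ.symm (quadmap σ t)
  rw [quadmap_symm_quadmap] at hr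
  have h1 := congrArg (fun x => x.1) hr
  have h2 := congrArg (fun x => x.2.1) hr
  have h3 := congrArg (fun x => x.2.2) hr
  simp only at h1 h2 h3
  unfold Row4Holds E3Ineq at h ⊢
  simp only [← prodBernoulli_real_preimage_relabel (sym2Equiv σ) w (relabelW σ w) (relabelW_apply σ w),
    Set.preimage_inter, preimage_relabel_connEvent, h1, h2, h3]
  exact h

/-- A four-point row at all weights for a quadruple gives the row at all weights for every relabelled quadruple. [this work] -/
theorem rowHolds4_forall_relabel (i : Fin 7) (σ : Fin n ≃ Fin n) {t : Quad n}
    (h : ∀ w : Sym2 (Fin n) → unitInterval, Row4Holds i w t) (w : Sym2 (Fin n) → unitInterval) :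
    Row4Holds i w (quadmap σ t) := by
  have hw : relabelW σ (fun e => w (sym2Equiv σ e)) = w := by
    funext e
    unfold relabelW
    simp only [Equiv.apply_symm_apply]
  rw [← hw]
  exact rowHolds4_relabel i σ _ t (h _)

/-! ## The evaluations (quadruples, `quad₀` and the relabelling covers are those of `…FourPointRowsLeFive`) -/

/-- `K₄`: class `(iii)` passes the three-copy check at the standard quadruple (base `2^22`). [this work] -/
theorem check4_row0 : checkE3 4 22 (row4 0 (quad₀ 4 le_rfl)).1 (row4 0 (quad₀ 4 le_rfl)).2.1 (row4 0 (quad₀ 4 le_rfl)).2.2 = true := by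
  native_decide
/-- `K₄`: class `(ii)` passes the three-copy check at the standard quadruple. [this work] -/
theorem check4_row1 : checkE3 4 22 (row4 1 (quad₀ 4 le_rfl)).1 (row4 1 (quad₀ 4 le_rfl)).2.1 (row4 1 (quad₀ 4 le_rfl)).2.2 = true := by
  native_decide
/-- `K₄`: class `(b)` passes the three-copy check at the standard quadruple. [this work] -/
theorem check4_row2 : checkE3 4 22 (row4 2 (quad₀ 4 le_rfl)).1 (row4 2 (quad₀ 4 le_rfl)).2.1 (row4 2 (quad₀ 4 le_rfl)).2.2 = true := by
  native_decide
/-- `K₄`: class `F` passes the three-copy check at the standard quadruple. [this work] -/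
theorem check4_row3 : checkE3 4 22 (row4 3 (quad₀ 4 le_rfl)).1 (row4 3 (quad₀ 4 le_rfl)).2.1 (row4 3 (quad₀ 4 le_rfl)).2.2 = true := by
  native_decide
/-- `K₄`: class `α` passes the three-copy check at the standard quadruple. [this work] -/
theorem check4_row4 : checkE3 4 22 (row4 4 (quad₀ 4 le_rfl)).1 (row4 4 (quad₀ 4 le_rfl)).2.1 (row4 4 (quad₀ 4 le_rfl)).2.2 = true := by
  native_decide
/-- `K₄`: class `β` passes the three-copy check at the standard quadruple. [this work] -/
theorem check4_row5 : checkE3 4 22 (row4 5 (quad₀ 4 le_rfl)).1 (row4 5 (quad₀ 4 le_rfl)).2.1 (row4 5 (quad₀ 4 le_rfl)).2.2 = true := by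
  native_decide
/-- `K₄`: class `γ` passes the three-copy check at the standard quadruple. [this work] -/
theorem check4_row6 : checkE3 4 22 (row4 6 (quad₀ 4 le_rfl)).1 (row4 6 (quad₀ 4 le_rfl)).2.1 (row4 6 (quad₀ 4 le_rfl)).2.2 = true := by
  native_decide

/-- `K₄`: all seven classes pass at the standard quadruple. [this work] -/
theorem check4_row (i : Fin 7) :
    checkE3 4 22 (row4 i (quad₀ 4 le_rfl)).1 (row4 i (quad₀ 4 le_rfl)).2.1 (row4 i (quad₀ 4 le_rfl)).2.2 = true := by
  fin_cases i
  exacts [check4_row0, check4_row1, check4_row2, check4_row3, check4_row4, check4_row5, check4_row6]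

/-- `K₅` (vertex `4` Steiner): class `(iii)` passes the three-copy check at the standard quadruple (base `2^34`). [this work] -/
theorem check5_row0 :
    checkE3 5 34 (row4 0 (quad₀ 5 (by norm_num))).1 (row4 0 (quad₀ 5 (by norm_num))).2.1 (row4 0 (quad₀ 5 (by norm_num))).2.2 = true := by
  native_decide
/-- `K₅`: class `(ii)` passes the three-copy check at the standard quadruple. [this work] -/
theorem check5_row1 :
    checkE3 5 34 (row4 1 (quad₀ 5 (by norm_num))).1 (row4 1 (quad₀ 5 (by norm_num))).2.1 (row4 1 (quad₀ 5 (by norm_num))).2.2 = true := by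
  native_decide
/-- `K₅`: class `(b)` passes the three-copy check at the standard quadruple. [this work] -/
theorem check5_row2 :
    checkE3 5 34 (row4 2 (quad₀ 5 (by norm_num))).1 (row4 2 (quad₀ 5 (by norm_num))).2.1 (row4 2 (quad₀ 5 (by norm_num))).2.2 = true := by
  native_decide
/-- `K₅`: class `F` passes the three-copy check at the standard quadruple. [this work] -/
theorem check5_row3 :
    checkE3 5 34 (row4 3 (quad₀ 5 (by norm_num))).1 (row4 3 (quad₀ 5 (by norm_num))).2.1 (row4 3 (quad₀ 5 (by norm_num))).2.2 = true := by
  native_decide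
/-- `K₅`: class `α` passes the three-copy check at the standard quadruple. [this work] -/
theorem check5_row4 :
    checkE3 5 34 (row4 4 (quad₀ 5 (by norm_num))).1 (row4 4 (quad₀ 5 (by norm_num))).2.1 (row4 4 (quad₀ 5 (by norm_num))).2.2 = true := by
  native_decide
/-- `K₅`: class `β` passes the three-copy check at the standard quadruple. [this work] -/
theorem check5_row5 :
    checkE3 5 34 (row4 5 (quad₀ 5 (by norm_num))).1 (row4 5 (quad₀ 5 (by norm_num))).2.1 (row4 5 (quad₀ 5 (by norm_num))).2.2 = true := by
  native_decide
/-- `K₅`: class `γ` passes the three-copy check at the standard quadruple. [this work] -/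
theorem check5_row6 :
    checkE3 5 34 (row4 6 (quad₀ 5 (by norm_num))).1 (row4 6 (quad₀ 5 (by norm_num))).2.1 (row4 6 (quad₀ 5 (by norm_num))).2.2 = true := by
  native_decide

/-- `K₅`: all seven classes pass at the standard quadruple. [this work] -/
theorem check5_row (i : Fin 7) :
    checkE3 5 34 (row4 i (quad₀ 5 (by norm_num))).1 (row4 i (quad₀ 5 (by norm_num))).2.1 (row4 i (quad₀ 5 (by norm_num))).2.2 =
      true := by
  fin_cases i
  exacts [check5_row0, check5_row1, check5_row2, check5_row3, check5_row4, check5_row5, check5_row6]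

/-- The classes on `Fin 4`. [this work] -/
theorem rowHolds4_four (i : Fin 7) (w : Sym2 (Fin 4) → unitInterval) (a b c y : Fin 4) (hab : a ≠ b) (hac : a ≠ c) (hay : a ≠ y)
    (hbc : b ≠ c) (hby : b ≠ y) (hcy : c ≠ y) : Row4Holds i w (a, b, c, y) := by
  obtain ⟨σ, hσ⟩ := cover_quad4 _ (mem_distinctQuad hab hac hay hbc hby hcy)
  rw [← hσ]
  exact rowHolds4_forall_relabel i σ (fun w' => e3_of_checkE3 (check4_row i) w') w

/-- The classes on `Fin 5` (the fifth vertex is a Steiner vertex). [this work] -/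
theorem rowHolds4_five (i : Fin 7) (w : Sym2 (Fin 5) → unitInterval) (a b c y : Fin 5) (hab : a ≠ b) (hac : a ≠ c) (hay : a ≠ y)
    (hbc : b ≠ c) (hby : b ≠ y) (hcy : c ≠ y) : Row4Holds i w (a, b, c, y) := by
  obtain ⟨σ, hσ⟩ := cover_quad5 _ (mem_distinctQuad hab hac hay hbc hby hcy)
  rw [← hσ]
  exact rowHolds4_forall_relabel i σ (fun w' => e3_of_checkE3 (check5_row i) w') w

/-! ## The theorem -/

/-- **The seven four-point E3GRP classes (Richards–Sahi `E₃ ≥ 0` on group separations of four terminals) hold on every weighted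
graph with at most five vertices**: for every class `i`, every `n ≤ 5`, every `w : Sym2 (Fin n) → [0,1]` and all pairwise distinct
`a b c y`, `E₃(A,B,C) ≥ 0` for the class's three group-separation events — by the kernel-checked three-copy certificates on `K₄` and
`K₅` (all tensor-Bernstein fibre sums nonnegative: Richards-comb positivity) and transport along vertex relabellings; `n ≤ 3` is
vacuous. [this work] -/
theorem fourPointClass_le_five (i : Fin 7) : ∀ n ≤ 5, ∀ (w : Sym2 (Fin n) → unitInterval) (a b c y : Fin n), a ≠ b → a ≠ c →
    a ≠ y → b ≠ c → b ≠ y → c ≠ y → Row4Holds i w (a, b, c, y) := by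
  intro n hn w a b c y hab hac hay hbc hby hcy
  interval_cases n
  · exact a.elim0
  · exact absurd (Subsingleton.elim a b) hab
  · have : c = a ∨ c = b := by omega
    rcases this with h | h
    · exact absurd h.symm hac
    · exact absurd h.symm hbc
  · have : y = a ∨ y = b ∨ y = c := by omega
    rcases this with h | h | h
    · exact absurd h.symm hay
    · exact absurd h.symm hby
    · exact absurd h.symm hcy
  · exact rowHolds4_four i w a b c y hab hac hay hbc hby hcy
  · exact rowHolds4_five i w a b c y hab hac hay hbc hby hcy

/-! ## The three previously open classes, spelled out in `openConn` notation -/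

/-- **Class `(iii)` on at most five vertices**: with `A = {a ↮ b}`, `B = {a ↮ c}`, `C = {b ↮ c, b ↮ y}` and `μ = prodBernoulli w`,
`μ(A)μ(B∩C) + μ(B)μ(A∩C) + μ(C)μ(A∩B) ≤ 2μ(A∩B∩C) + μ(A)μ(B)μ(C)`. [this work] -/
theorem classIII_le_five : ∀ n ≤ 5, ∀ (w : Sym2 (Fin n) → unitInterval) (a b c y : Fin n), a ≠ b → a ≠ c → a ≠ y → b ≠ c →
    b ≠ y → c ≠ y → E3Ineq w (sep [a] [b]) (sep [a] [c]) (sep [b] [c, y]) :=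
  fun n hn w a b c y hab hac hay hbc hby hcy => fourPointClass_le_five 0 n hn w a b c y hab hac hay hbc hby hcy

/-- **Class `α` on at most five vertices**: `E₃(U[a|bc], U[ab|c], U[acy|b]) ≥ 0`. [this work] -/
theorem classAlpha_le_five : ∀ n ≤ 5, ∀ (w : Sym2 (Fin n) → unitInterval) (a b c y : Fin n), a ≠ b → a ≠ c → a ≠ y → b ≠ c →
    b ≠ y → c ≠ y → E3Ineq w (lnk [a] [b, c]) (lnk [a, b] [c]) (lnk [a, c, y] [b]) :=
  fun n hn w a b c y hab hac hay hbc hby hcy => fourPointClass_le_five 4 n hn w a b c y hab hac hay hbc hby hcy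

/-- **Class `β` on at most five vertices**: `E₃(U[a|bcy], U[ab|cy], U[acy|b]) ≥ 0`. [this work] -/
theorem classBeta_le_five : ∀ n ≤ 5, ∀ (w : Sym2 (Fin n) → unitInterval) (a b c y : Fin n), a ≠ b → a ≠ c → a ≠ y → b ≠ c →
    b ≠ y → c ≠ y → E3Ineq w (lnk [a] [b, c, y]) (lnk [a, b] [c, y]) (lnk [a, c, y] [b]) :=
  fun n hn w a b c y hab hac hay hbc hby hcy => fourPointClass_le_five 5 n hn w a b c y hab hac hay hbc hby hcy

end Summit.CriticalPhenomena.PercolationContinuityZ3.Theorems.E3GroupSepCert
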